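/-
COR-CM (cell pub-hodgecm2) — THE HECKE OPERATOR `T_γ = τ'_{f₁} ∘ g^*` ON `H¹(X_Γ(ℂ); ℚ)` OF THE REALISING PICARD MODULAR
SURFACES IS A HODGE ENDOMORPHISM, AND IS SEMISIMPLE GIVEN (ℓ) AN INVARIANT KÄHLER CLASS AND (R3) COMMUTATION WITH ITS
TRANSPOSE; with the tree's `HeckeInvariantKaehlerDatum` (p319488) discharging (ℓ), the ONLY displayed hypothesis of
semisimplicity is (R3).  Lane «L-BYPASS LEAVES» (b10 gen 22): CorCM capstone of the generic Literature leaves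
`FiniteCoverTransferComparison` (p320714), `FiniteCoverTransferAdjointPairing`, `SurfaceCorrespondenceSemisimple` and the
junction `LevelCoreHeckeTranslate`; kernel text by the seat pub-hodgecm2-s2crux-idea-2 (probes RA-v26 Part E, RA-v28,
RA-v30 Part H, gens 7–8), §3 by b10; filed by b10.  Count-neutral: no BINDER-OWNERS row, nothing under
`B01/Transposition`, Interfaces (C1) / E term untouched.  HC_CM is NOT proved; B01-S is NOT discharged; this file
inhabits no binder of the END display; it is one segment ((M1) → semisimplicity) of ONE hedge derivation of B01-S.
-/
import Summits.HodgeConjecture.CorCM.Geometry.LevelCoreHeckeTranslate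
import Summits.HodgeConjecture.CorCM.Geometry.HeckeInvariantKaehlerDatum
import Literature.AlgebraicGeometry.HodgeTheory.SurfaceCorrespondenceSemisimple
import Literature.AlgebraicTopology.SingularHomology.FiniteCoverTransferComparison
import Literature.AlgebraicGeometry.HodgeTheory.TopDegreeClasses
import HarnessLib

set_option autoImplicit false

/-!
# Hecke operators on `H¹` of the realising Picard modular surfaces: Hodge-compatible, and semisimple when normal

`X_Γ = Var.scheme hU h₃ (.pms (pmsCode L ι₁ V Γ))`, `Γ : Level V` a torsion-free level of an anisotropic hermitian
`3`-space `V` over the CM field `L`, `γ ∈ U(V)(L)`.  The HECKE OPERATOR of `γ` on `H¹(X_Γ(ℂ); ℚ)` is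
`T_γ = τ'_{f₁} ∘ g^*` for the Hecke pair `(f₁, g) : X_{Γ'} ⇉ X_Γ` (`Γ' = Γ ∩ γ⁻¹Γγ`, `f₁` the level map over `v ↦ v`,
`g` the Hecke translate over `v ↦ γ^{ι₁} v`, `τ'` the normalised transfer of the finite covering `f₁(ℂ)`), and its
transpose is `ᵗT_γ = τ'_g ∘ f₁^*`.

* §1 `Model.exists_heckeOperator_isSemisimple_one` — on a tower `X_N → X_{Γ'} ⇉ X_Γ` with `N` Galois in `Γ`:
  (R1) **`T_γ` is a HODGE ENDOMORPHISM** of the weight-one Hodge structure of record (`|G| • T_γ = τ_c ∘ (q ≫ g)^*` for the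
  deck transfer `τ_c` of the Galois cover, `FiniteCoverTransferComparison` + `LevelCoreHeckeTranslate`), and **`T_γ` is
  SEMISIMPLE** as soon as (ℓ) `f₁^* η = g^* η` for a Kähler–rational datum of `X_Γ` and (R3) `Commute T_γ ᵗT_γ`
  (`SurfaceCorrespondenceSemisimple`: `T_γ` is then normal for the polarisation of `H¹`).
* §2 `exists_heckeOperator_isSemisimple_one'`, `…_one''`, `exists_heckeOperator_isSemisimple_heckePair` — the same with
  the finite-covering structure of `g(ℂ)` SUPPLIED (`exists_heckeTranslate_isFiniteCover`), the Galois level SUPPLIED as the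
  normal core `Γ.core Γ'`, and finally on the tree's Hecke pair `Level.heckePair Γ γ hγ`: inputs = `Γ`, anisotropy,
  `γ ∈ U(V)(L)`; displayed hypotheses of semisimplicity = (ℓ) + (R3).
* §3 `exists_heckeOperator_isSemisimple_heckePair_of_commute` — (ℓ) DISCHARGED by the tree's
  `Model.exists_kaehlerRationalDatum_pull_levelCover_eq_pull_heckeTranslate` (`HeckeInvariantKaehlerDatum`): **`T_γ` is a
  Hodge endomorphism of `H¹(X_Γ(ℂ); ℚ)`, semisimple whenever it commutes with `ᵗT_γ`** — the one displayed hypothesis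
  left is (R3) (classically `ᵗT_γ = T_{γ⁻¹}` and the spherical Hecke algebra is commutative, Shimura 1971 §3).

See also (different objects, no shared statement): TEAM hComp's `Transposition/HComp/` lane B → A
(`HeckeTranslatesOfRecord` / `HeckeTranslatesOfSec42DataOf`, `heckeTranslatesFamilyOf`: the Hecke TRANSLATE morphisms
`t_g : X_{K'} → X_K` of the canonical-model record system and their field of definition, feeding the displayed binder `T` of
the S7 END display) — here the objects are the Hecke OPERATORS on `H¹` of the complex ball-quotient tower and their
semisimplicity; the only common ground is the finite-cover functoriality of `Level.heckePair` (lead gen 9, HOME/INBOX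
2026-08-22T07:23:47Z (2); consolidation, if any, later).

References: G. Shimura, *Introduction to the Arithmetic Theory of Automorphic Functions* (1971), §3.1 Prop. 3.1, §3.2–3.4,
§7.2–7.3 [Shimura1971]; N. Bergeron, J. Millson, C. Moeglin, Acta Math. 216 (2016), Part 2 §1.8
[BergeronMillsonMoeglin2016Balls]; A. Hatcher, *Algebraic Topology* (2002), §3.G [HatcherAT2002]; C. Voisin, *Hodge Theory
and Complex Algebraic Geometry I* (2002), §7.1.2 [VoisinHodgeI2002]; H. Lange, *Abelian Varieties over the Complex Numbers*
(2023), §2.4.1 Thm. 2.4.9 [Lange2023AbelianVarietiesC].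
-/

noncomputable section

open CategoryTheory Matrix
open Literature.AlgebraicGeometry.Motives (SchemeOver ComplexPoints AlgPoints bettiCohomology)
open Literature.AlgebraicGeometry.HodgeTheory
open Literature.AlgebraicGeometry.ShimuraVarieties
open Literature.AlgebraicTopology.SingularHomology

namespace Summit.HodgeConjecture.CorCM.Model

open NumberField
open Literature.NumberTheory.Automorphic
open Literature.NumberTheory.Automorphic.PicardCM

/-! ## §1 The Hecke operator on a Galois tower: Hodge-compatible; semisimple given (ℓ) and (R3) -/

section HeckeSemisimple

variable {hU : BallQuotientUniformisedDatum} {h₃ : CMAbelianVarietyRealised}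
variable {L : CMField} {ι₁ : L →+* ℂ} {V : HermSpace3 L ι₁}

/-- Two maps of complex points of levels of the tower that agree on the uniformised cone agree:
`f_N(ℂ) = f₁(ℂ) ∘ q(ℂ)` for level maps `X_N → X_Γ`, `X_N → X_{Γ'}`, `X_{Γ'} → X_Γ` (all three are determined by
their values on the dense uniformised cone). [cite: BergeronMillsonMoeglin2016Balls, Part 2 §1.8] -/
theorem mapContinuous_eq_comp_of_unif {Γ Γ' N : Level V} (hN : (pmsCode L ι₁ V N).IsAnisotropic)
    (h' : (pmsCode L ι₁ V Γ').IsAnisotropic) (h : (pmsCode L ι₁ V Γ).IsAnisotropic)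
    {fN : Var.scheme hU h₃ (.pms (pmsCode L ι₁ V N)) ⟶ Var.scheme hU h₃ (.pms (pmsCode L ι₁ V Γ))}
    {q : Var.scheme hU h₃ (.pms (pmsCode L ι₁ V N)) ⟶ Var.scheme hU h₃ (.pms (pmsCode L ι₁ V Γ'))}
    {f₁ : Var.scheme hU h₃ (.pms (pmsCode L ι₁ V Γ')) ⟶ Var.scheme hU h₃ (.pms (pmsCode L ι₁ V Γ))}
    (hfN : ∀ v ∈ (Var.ballDatum hU h₃ (pmsCode L ι₁ V N) hN).cone,
      AlgPoints.map fN ((Var.ballDatum hU h₃ (pmsCode L ι₁ V N) hN).unif v) =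
        (Var.ballDatum hU h₃ (pmsCode L ι₁ V Γ) h).unif v)
    (hq : ∀ v ∈ (Var.ballDatum hU h₃ (pmsCode L ι₁ V N) hN).cone,
      AlgPoints.map q ((Var.ballDatum hU h₃ (pmsCode L ι₁ V N) hN).unif v) =
        (Var.ballDatum hU h₃ (pmsCode L ι₁ V Γ') h').unif v)
    (hf₁ : ∀ v ∈ (Var.ballDatum hU h₃ (pmsCode L ι₁ V Γ') h').cone,
      AlgPoints.map f₁ ((Var.ballDatum hU h₃ (pmsCode L ι₁ V Γ') h').unif v) =
        (Var.ballDatum hU h₃ (pmsCode L ι₁ V Γ) h).unif v) :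
    AlgPoints.mapContinuous (L := ℂ) fN =
      (AlgPoints.mapContinuous (L := ℂ) f₁).comp (AlgPoints.mapContinuous (L := ℂ) q) := by
  refine ContinuousMap.ext fun P => ?_
  obtain ⟨v, hv, rfl⟩ := (Var.ballDatum hU h₃ (pmsCode L ι₁ V N) hN).surjOn_unif (Set.mem_univ P)
  have hv' : v ∈ (Var.ballDatum hU h₃ (pmsCode L ι₁ V Γ') h').cone := by
    show v ∈ negCone (Var.ballDatum hU h₃ (pmsCode L ι₁ V Γ') h').Hℂ
    rw [← ballDatum_Hℂ_eq hU h₃ Γ' N hN h']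
    exact hv
  rw [ContinuousMap.comp_apply, AlgPoints.mapContinuous_apply, AlgPoints.mapContinuous_apply,
    AlgPoints.mapContinuous_apply, hfN v hv, hq v hv, hf₁ v hv']

/-- **The Hecke operator `T_γ = τ'_{f₁} ∘ g^*` on `H¹(X_Γ(ℂ); ℚ)` is semisimple, given (ℓ) and (R3).**
Tower `X_N → X_{Γ'} ⇉ X_Γ` of an anisotropic hermitian space: `N ≤ Γ' ≤ Γ` torsion-free levels with
`N` normal in `Γ` (a normal core), `γ ∈ U(V₃,h)(L)` with `γ Γ' γ⁻¹ ≤ Γ`; `f₁` the level map, `g` the Hecke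
translate (`g(ℂ)(unif' v) = unif(γ^{ι₁} v)`), `τ'_{f₁}` the normalised transfer of the finite covering
`f₁(ℂ)`.  (R1) HODGE-COMPATIBILITY of `T_γ` is PROVED here: `|G| • T_γ = τ_c ∘ (q ≫ g)^*` for the deck
transfer `τ_c` of the Galois cover `X_N(ℂ) → X_Γ(ℂ)` (`transferMap_comp_map_mem_of_deck`), which is a Hodge endomorphism (`exists_levelDeckCover_hodge_ballDatum`).
Given moreover that `g(ℂ)` is a finite covering, a Kähler–rational datum `D` of `X_Γ` with
(ℓ) `f₁^* η = g^* η`, and (R3) `T_γ` commutes with its transpose `τ'_g ∘ f₁^*`, the operator `T_γ` is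
`Q`-normal for the polarisation of record on `H¹` and hence SEMISIMPLE (`SurfaceCorrespondenceSemisimple.isSemisimple_transferMap_comp_map_one`).
[cite: Shimura1971, §3.2–3.4 and §7.2–7.3] [cite: HatcherAT2002, §3.G p. 321]
[cite: VoisinHodgeI2002, §7.1.2] [cite: Lange2023AbelianVarietiesC, §2.4.1 Thm. 2.4.9] -/
theorem exists_heckeOperator_isSemisimple_one (hHD : exists_isReal_hodgeModel)
    (hI : hodgePQ_independent_of_hodgeModel) {Γ Γ' N : Level V} (hle : Γ'.Γ ≤ Γ.Γ) (hNle : N.Γ ≤ Γ'.Γ)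
    (h : (pmsCode L ι₁ V Γ).IsAnisotropic) (h' : (pmsCode L ι₁ V Γ').IsAnisotropic)
    (hN : (pmsCode L ι₁ V N).IsAnisotropic)
    [hNn : ((N.Γ.map (Matrix.GeneralLinearGroup.map ι₁)).subgroupOf
      (Γ.Γ.map (Matrix.GeneralLinearGroup.map ι₁))).Normal]
    [Fintype (↥(Γ.Γ.map (Matrix.GeneralLinearGroup.map ι₁)) ⧸
      (N.Γ.map (Matrix.GeneralLinearGroup.map ι₁)).subgroupOf (Γ.Γ.map (Matrix.GeneralLinearGroup.map ι₁)))]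
    {γ : GL (Fin 3) L} (hγ : γ ∈ unitaryGroup (cmConjRingHom L) V.Hm)
    (hconj : Γ'.Γ.map (MulAut.conj γ).toMonoidHom ≤ Γ.Γ) :
    ∃ (f₁ g : Var.scheme hU h₃ (.pms (pmsCode L ι₁ V Γ')) ⟶ Var.scheme hU h₃ (.pms (pmsCode L ι₁ V Γ)))
      (c₁ : IsFiniteCover (AlgPoints.mapContinuous (L := ℂ) f₁)),
      (∀ v ∈ (Var.ballDatum hU h₃ (pmsCode L ι₁ V Γ') h').cone,
        AlgPoints.map f₁ ((Var.ballDatum hU h₃ (pmsCode L ι₁ V Γ') h').unif v) =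
          (Var.ballDatum hU h₃ (pmsCode L ι₁ V Γ) h).unif v) ∧
      (∀ v ∈ (Var.ballDatum hU h₃ (pmsCode L ι₁ V Γ') h').cone,
        AlgPoints.map g ((Var.ballDatum hU h₃ (pmsCode L ι₁ V Γ') h').unif v) =
          (Var.ballDatum hU h₃ (pmsCode L ι₁ V Γ) h).unif (((γ : Matrix (Fin 3) (Fin 3) L).map ι₁) *ᵥ v)) ∧
      (c₁.transferMap (R := ℚ) 1).hom ∘ₗ BettiUniverse.pull g 1 ∈
        (BettiUniverse.hodge hHD (Var.isSmoothProjective hU h₃ (.pms (pmsCode L ι₁ V Γ))) 1).endAlg ∧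
      ∀ (c₂ : IsFiniteCover (AlgPoints.mapContinuous (L := ℂ) g))
        (D : KaehlerRationalDatum 2 (Var.scheme hU h₃ (.pms (pmsCode L ι₁ V Γ)))),
        BettiUniverse.pull f₁ 2 D.η = BettiUniverse.pull g 2 D.η →
        Commute ((c₁.transferMap (R := ℚ) 1).hom ∘ₗ BettiUniverse.pull g 1)
          ((c₂.transferMap (R := ℚ) 1).hom ∘ₗ BettiUniverse.pull f₁ 1) →
        Module.End.IsSemisimple ((c₁.transferMap (R := ℚ) 1).hom ∘ₗ BettiUniverse.pull g 1) := by
  -- the Galois cover `X_N(ℂ) → X_Γ(ℂ)` with its deck group and Hodge-compatible transfers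
  obtain ⟨fN, inst, c, hfN, hcproj, hHdg, -⟩ :=
    exists_levelDeckCover_hodge_ballDatum (hU := hU) (h₃ := h₃) hHD hI (hNle.trans hle) hN h
  -- the level maps `q : X_N → X_{Γ'}`, `f₁ : X_{Γ'} → X_Γ` and the Hecke translate `g`
  obtain ⟨q, hq⟩ := exists_levelCover hU h₃ hHD hNle hN h'
  obtain ⟨f₁, hf₁⟩ := exists_levelCover hU h₃ hHD hle h' h
  obtain ⟨g, hg⟩ := exists_heckeTranslate hU h₃ hHD hγ hconj h' h
  -- finite coverings
  have cq : IsFiniteCover (AlgPoints.mapContinuous (L := ℂ) q) :=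
    UnitaryBallUniformisationDatum.isFiniteCover_of_unif_comp (ballDatum_Hℂ_eq hU h₃ Γ' N hN h')
      (AlgPoints.mapContinuous (L := ℂ) q) (fun v hv => hq v hv)
  have cp : IsFiniteCover (AlgPoints.mapContinuous (L := ℂ) f₁) :=
    UnitaryBallUniformisationDatum.isFiniteCover_of_unif_comp (ballDatum_Hℂ_eq hU h₃ Γ Γ' h' h)
      (AlgPoints.mapContinuous (L := ℂ) f₁) (fun v hv => hf₁ v hv)
  -- `c.proj = f₁(ℂ) ∘ q(ℂ)`
  have hc : c.proj = (AlgPoints.mapContinuous (L := ℂ) f₁).comp (AlgPoints.mapContinuous (L := ℂ) q) :=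
    hcproj.trans (mapContinuous_eq_comp_of_unif hN h' h hfN hq hf₁)
  -- constant sheet number of `q(ℂ)` over the connected `X_{Γ'}(ℂ)`
  haveI := connectedSpace_complexPoints (Var.isSmoothProjective hU h₃ (.pms (pmsCode L ι₁ V Γ')))
  obtain ⟨d, hd⟩ := cq.exists_ncard_fibre_eq
  -- (R1): Hodge-compatibility of `τ_c ∘ (q ≫ g)^*`, transported to `τ'_{f₁} ∘ g^*`
  have hA := hHdg 1 (q ≫ g)
  rw [show BettiUniverse.pull (q ≫ g) 1 = (singularCohomology.map ℚ ℚ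
      ((AlgPoints.mapContinuous (L := ℂ) g).comp (AlgPoints.mapContinuous (L := ℂ) q)) 1).hom from by
    rw [← AlgPoints.mapContinuous_comp]] at hA
  have hT := transferMap_comp_map_mem_of_deck c cq cp hc d hd hA
  refine ⟨f₁, g, cp, hf₁, hg, hT, fun c₂ D hη hcomm => ?_⟩
  exact isSemisimple_transferMap_comp_map_one hHD (Var.isSmoothProjective hU h₃ (.pms (pmsCode L ι₁ V Γ))) D cp c₂
    (finrank_rat_top (Var.isSmoothProjective hU h₃ (.pms (pmsCode L ι₁ V Γ')))) hη hT hcomm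

end HeckeSemisimple

/-! ## §2 Supplying the finite covering `g(ℂ)` and the Galois level `Γ.core Γ'`; the Hecke pair -/

section HeckeFiniteCover

variable {hU : BallQuotientUniformisedDatum} {h₃ : CMAbelianVarietyRealised}
variable {L : CMField} {ι₁ : L →+* ℂ} {V : HermSpace3 L ι₁}

/-- **Capstone, finite-cover binder discharged.**  On the tower `X_N → X_{Γ'} ⇉ X_Γ` of an anisotropic hermitian
space (`N ≤ Γ' ≤ Γ` torsion-free levels, `N` normal of finite index in `Γ` after `ι₁`, `γ ∈ U(V₃,h)(L)` with
`γ Γ' γ⁻¹ ≤ Γ`) there are the level map `f₁`, the Hecke translate `g` and finite-covering structures `c₁`, `c₂` on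
`f₁(ℂ)`, `g(ℂ)` ((G-fin), `exists_heckeTranslate_isFiniteCover`) such that `T_γ = τ'_{f₁} ∘ g^*` is a Hodge endomorphism of `H¹(X_Γ(ℂ); ℚ)` ((R1)) and is SEMISIMPLE as soon as (ℓ) `f₁^* η = g^* η` for the Kähler class of a Kähler–rational datum of
`X_Γ` and (R3) `T_γ` commutes with its transpose `τ'_g ∘ f₁^*` (`SurfaceCorrespondenceSemisimple.isSemisimple_transferMap_comp_map_one`).
[cite: Shimura1971, §3.2–3.4 and §7.2–7.3] [cite: BergeronMillsonMoeglin2016Balls, Part 2 §1.8]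
[cite: HatcherAT2002, §3.G p. 321] [cite: VoisinHodgeI2002, §7.1.2] [cite: Lange2023AbelianVarietiesC, §2.4.1 Thm. 2.4.9] -/
theorem exists_heckeOperator_isSemisimple_one' (hHD : exists_isReal_hodgeModel)
    (hI : hodgePQ_independent_of_hodgeModel) {Γ Γ' N : Level V} (hle : Γ'.Γ ≤ Γ.Γ) (hNle : N.Γ ≤ Γ'.Γ)
    (h : (pmsCode L ι₁ V Γ).IsAnisotropic) (h' : (pmsCode L ι₁ V Γ').IsAnisotropic)
    (hN : (pmsCode L ι₁ V N).IsAnisotropic)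
    [((N.Γ.map (Matrix.GeneralLinearGroup.map ι₁)).subgroupOf
      (Γ.Γ.map (Matrix.GeneralLinearGroup.map ι₁))).Normal]
    [Fintype (↥(Γ.Γ.map (Matrix.GeneralLinearGroup.map ι₁)) ⧸
      (N.Γ.map (Matrix.GeneralLinearGroup.map ι₁)).subgroupOf (Γ.Γ.map (Matrix.GeneralLinearGroup.map ι₁)))]
    {γ : GL (Fin 3) L} (hγ : γ ∈ unitaryGroup (cmConjRingHom L) V.Hm)
    (hconj : Γ'.Γ.map (MulAut.conj γ).toMonoidHom ≤ Γ.Γ) :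
    ∃ (f₁ g : Var.scheme hU h₃ (.pms (pmsCode L ι₁ V Γ')) ⟶ Var.scheme hU h₃ (.pms (pmsCode L ι₁ V Γ)))
      (c₁ : IsFiniteCover (AlgPoints.mapContinuous (L := ℂ) f₁))
      (c₂ : IsFiniteCover (AlgPoints.mapContinuous (L := ℂ) g)),
      (∀ v ∈ (Var.ballDatum hU h₃ (pmsCode L ι₁ V Γ') h').cone,
        AlgPoints.map f₁ ((Var.ballDatum hU h₃ (pmsCode L ι₁ V Γ') h').unif v) =
          (Var.ballDatum hU h₃ (pmsCode L ι₁ V Γ) h).unif v) ∧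
      (∀ v ∈ (Var.ballDatum hU h₃ (pmsCode L ι₁ V Γ') h').cone,
        AlgPoints.map g ((Var.ballDatum hU h₃ (pmsCode L ι₁ V Γ') h').unif v) =
          (Var.ballDatum hU h₃ (pmsCode L ι₁ V Γ) h).unif (((γ : Matrix (Fin 3) (Fin 3) L).map ι₁) *ᵥ v)) ∧
      (c₁.transferMap (R := ℚ) 1).hom ∘ₗ BettiUniverse.pull g 1 ∈
        (BettiUniverse.hodge hHD (Var.isSmoothProjective hU h₃ (.pms (pmsCode L ι₁ V Γ))) 1).endAlg ∧
      ∀ (D : KaehlerRationalDatum 2 (Var.scheme hU h₃ (.pms (pmsCode L ι₁ V Γ)))),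
        BettiUniverse.pull f₁ 2 D.η = BettiUniverse.pull g 2 D.η →
        Commute ((c₁.transferMap (R := ℚ) 1).hom ∘ₗ BettiUniverse.pull g 1)
          ((c₂.transferMap (R := ℚ) 1).hom ∘ₗ BettiUniverse.pull f₁ 1) →
        Module.End.IsSemisimple ((c₁.transferMap (R := ℚ) 1).hom ∘ₗ BettiUniverse.pull g 1) := by
  obtain ⟨f₁, g, c₁, hf₁, hg, hT, hrest⟩ :=
    exists_heckeOperator_isSemisimple_one (hU := hU) (h₃ := h₃) hHD hI hle hNle h h' hN hγ hconj
  exact ⟨f₁, g, c₁, isFiniteCover_mapContinuous_of_map_unif_mulVec hγ h' h hg, hf₁, hg, hT,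
    fun D hη hcomm => hrest _ D hη hcomm⟩

end HeckeFiniteCover

section HeckeCore

variable {hU : BallQuotientUniformisedDatum} {h₃ : CMAbelianVarietyRealised}
variable {L : CMField} {ι₁ : L →+* ℂ} {V : HermSpace3 L ι₁}

/-- **Capstone, both group-side binders discharged.**  For torsion-free levels `Γ' ≤ Γ` (in `GL₃(L)`) of an
anisotropic hermitian space and `γ ∈ U(V₃,h)(L)` with `γ Γ' γ⁻¹ ≤ Γ` there are the level map `f₁ : X_{Γ'} ⟶ X_Γ`,
the Hecke translate `g` (over `v ↦ γ^{ι₁} v`) and finite-covering structures `c₁, c₂` on `f₁(ℂ), g(ℂ)` such that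
`T_γ = τ'_{f₁} ∘ g^*` is a Hodge endomorphism of `H¹(X_Γ(ℂ); ℚ)` and is SEMISIMPLE as soon as
(ℓ) `f₁^* η = g^* η` for the Kähler class `η` of some Kähler–rational datum of `X_Γ` and (R3) `T_γ` commutes with
its transpose `τ'_g ∘ f₁^*`.  The Galois level is the normal core `Γ.core Γ'` (`LevelCoreHeckeTranslate`); the finite-cover structure
on `g(ℂ)` is frame transport (`UnitaryBallHeckeTranslateFiniteCover`).
[cite: Shimura1971, §3.1 Prop. 3.1, §3.2–3.4, §7.2–7.3] [cite: BergeronMillsonMoeglin2016Balls, Part 2 §1.8]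
[cite: HatcherAT2002, §3.G p. 321] [cite: VoisinHodgeI2002, §7.1.2] [cite: Lange2023AbelianVarietiesC, §2.4.1 Thm. 2.4.9] -/
theorem exists_heckeOperator_isSemisimple_one'' (hHD : exists_isReal_hodgeModel)
    (hI : hodgePQ_independent_of_hodgeModel) {Γ Γ' : Level V} (hle : Γ'.Γ ≤ Γ.Γ)
    (h : (pmsCode L ι₁ V Γ).IsAnisotropic) (h' : (pmsCode L ι₁ V Γ').IsAnisotropic)
    {γ : GL (Fin 3) L} (hγ : γ ∈ unitaryGroup (cmConjRingHom L) V.Hm)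
    (hconj : Γ'.Γ.map (MulAut.conj γ).toMonoidHom ≤ Γ.Γ) :
    ∃ (f₁ g : Var.scheme hU h₃ (.pms (pmsCode L ι₁ V Γ')) ⟶ Var.scheme hU h₃ (.pms (pmsCode L ι₁ V Γ)))
      (c₁ : IsFiniteCover (AlgPoints.mapContinuous (L := ℂ) f₁))
      (c₂ : IsFiniteCover (AlgPoints.mapContinuous (L := ℂ) g)),
      (∀ v ∈ (Var.ballDatum hU h₃ (pmsCode L ι₁ V Γ') h').cone,
        AlgPoints.map f₁ ((Var.ballDatum hU h₃ (pmsCode L ι₁ V Γ') h').unif v) =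
          (Var.ballDatum hU h₃ (pmsCode L ι₁ V Γ) h).unif v) ∧
      (∀ v ∈ (Var.ballDatum hU h₃ (pmsCode L ι₁ V Γ') h').cone,
        AlgPoints.map g ((Var.ballDatum hU h₃ (pmsCode L ι₁ V Γ') h').unif v) =
          (Var.ballDatum hU h₃ (pmsCode L ι₁ V Γ) h).unif (((γ : Matrix (Fin 3) (Fin 3) L).map ι₁) *ᵥ v)) ∧
      (c₁.transferMap (R := ℚ) 1).hom ∘ₗ BettiUniverse.pull g 1 ∈
        (BettiUniverse.hodge hHD (Var.isSmoothProjective hU h₃ (.pms (pmsCode L ι₁ V Γ))) 1).endAlg ∧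
      ∀ (D : KaehlerRationalDatum 2 (Var.scheme hU h₃ (.pms (pmsCode L ι₁ V Γ)))),
        BettiUniverse.pull f₁ 2 D.η = BettiUniverse.pull g 2 D.η →
        Commute ((c₁.transferMap (R := ℚ) 1).hom ∘ₗ BettiUniverse.pull g 1)
          ((c₂.transferMap (R := ℚ) 1).hom ∘ₗ BettiUniverse.pull f₁ 1) →
        Module.End.IsSemisimple ((c₁.transferMap (R := ℚ) 1).hom ∘ₗ BettiUniverse.pull g 1) := by
  haveI := normal_map_Γ (ι₁ := ι₁) (Level.core_Γ_le_left Γ Γ') (Level.normal_core_Γ_subgroupOf Γ Γ')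
  haveI := fintypeDeckGroup (ι₁ := ι₁) Γ (Γ.core Γ')
  exact exists_heckeOperator_isSemisimple_one' (hU := hU) (h₃ := h₃) hHD hI hle (Level.core_Γ_le_right Γ Γ') h h'
    ((isAnisotropic_pmsCode_iff_of_level Γ (Γ.core Γ')).2 h) hγ hconj

/-- **The Hecke pair instance**: for a torsion-free level `Γ` and `γ ∈ U(V₃,h)(L)`, on the Hecke pair
`X_{Γ ∩ γ⁻¹Γγ} ⇉ X_Γ` (tree `Level.heckePair`) the Hecke operator `T_γ` on `H¹(X_Γ(ℂ); ℚ)` EXISTS as a Hodge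
endomorphism built from two finite coverings, and is semisimple given (ℓ) and (R3) — every other input is
discharged in the kernel. [cite: Shimura1971, §3.1 Prop. 3.1, §7.2–7.3] -/
theorem exists_heckeOperator_isSemisimple_heckePair (hHD : exists_isReal_hodgeModel)
    (hI : hodgePQ_independent_of_hodgeModel) (Γ : Level V) (h : (pmsCode L ι₁ V Γ).IsAnisotropic)
    {γ : GL (Fin 3) L} (hγ : γ ∈ unitaryGroup (cmConjRingHom L) V.Hm) :
    ∃ (f₁ g : Var.scheme hU h₃ (.pms (pmsCode L ι₁ V (Γ.heckePair γ hγ))) ⟶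
        Var.scheme hU h₃ (.pms (pmsCode L ι₁ V Γ)))
      (c₁ : IsFiniteCover (AlgPoints.mapContinuous (L := ℂ) f₁))
      (c₂ : IsFiniteCover (AlgPoints.mapContinuous (L := ℂ) g)),
      (∀ v ∈ (Var.ballDatum hU h₃ (pmsCode L ι₁ V (Γ.heckePair γ hγ))
          ((isAnisotropic_pmsCode_iff_of_level Γ (Γ.heckePair γ hγ)).2 h)).cone,
        AlgPoints.map f₁ ((Var.ballDatum hU h₃ (pmsCode L ι₁ V (Γ.heckePair γ hγ))
          ((isAnisotropic_pmsCode_iff_of_level Γ (Γ.heckePair γ hγ)).2 h)).unif v) =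
          (Var.ballDatum hU h₃ (pmsCode L ι₁ V Γ) h).unif v) ∧
      (∀ v ∈ (Var.ballDatum hU h₃ (pmsCode L ι₁ V (Γ.heckePair γ hγ))
          ((isAnisotropic_pmsCode_iff_of_level Γ (Γ.heckePair γ hγ)).2 h)).cone,
        AlgPoints.map g ((Var.ballDatum hU h₃ (pmsCode L ι₁ V (Γ.heckePair γ hγ))
          ((isAnisotropic_pmsCode_iff_of_level Γ (Γ.heckePair γ hγ)).2 h)).unif v) =
          (Var.ballDatum hU h₃ (pmsCode L ι₁ V Γ) h).unif (((γ : Matrix (Fin 3) (Fin 3) L).map ι₁) *ᵥ v)) ∧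
      (c₁.transferMap (R := ℚ) 1).hom ∘ₗ BettiUniverse.pull g 1 ∈
        (BettiUniverse.hodge hHD (Var.isSmoothProjective hU h₃ (.pms (pmsCode L ι₁ V Γ))) 1).endAlg ∧
      ∀ (D : KaehlerRationalDatum 2 (Var.scheme hU h₃ (.pms (pmsCode L ι₁ V Γ)))),
        BettiUniverse.pull f₁ 2 D.η = BettiUniverse.pull g 2 D.η →
        Commute ((c₁.transferMap (R := ℚ) 1).hom ∘ₗ BettiUniverse.pull g 1)
          ((c₂.transferMap (R := ℚ) 1).hom ∘ₗ BettiUniverse.pull f₁ 1) →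
        Module.End.IsSemisimple ((c₁.transferMap (R := ℚ) 1).hom ∘ₗ BettiUniverse.pull g 1) :=
  exists_heckeOperator_isSemisimple_one'' (hU := hU) (h₃ := h₃) hHD hI (Level.heckePair_Γ_le Γ hγ) h
    ((isAnisotropic_pmsCode_iff_of_level Γ (Γ.heckePair γ hγ)).2 h) hγ (Level.map_conj_heckePair_Γ_le Γ hγ)

end HeckeCore

/-! ## §3 (ℓ) discharged: the Hecke operator is semisimple whenever it commutes with its transpose -/

section Normal

variable {hU : BallQuotientUniformisedDatum} {h₃ : CMAbelianVarietyRealised}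
variable {L : CMField} {ι₁ : L →+* ℂ} {V : HermSpace3 L ι₁}

/-- **The Hecke operator `T_γ` on `H¹(X_Γ(ℂ); ℚ)` is a Hodge endomorphism, and is semisimple whenever it commutes with
its transpose `ᵗT_γ`.**  For a torsion-free level `Γ` of an anisotropic hermitian space and `γ ∈ U(V₃,h)(L)`, on the Hecke
pair `X_{Γ ∩ γ⁻¹Γγ} ⇉ X_Γ`: there are the level map `f₁`, the Hecke translate `g` and finite-covering structures `c₁, c₂`
with `T_γ := τ'_{f₁} ∘ g^* ∈ End_Hdg H¹(X_Γ(ℂ); ℚ)` and `Commute T_γ (τ'_g ∘ f₁^*) → T_γ` semisimple — (ℓ) is supplied by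
the cover-stable Kähler–rational datum of the tree's `exists_kaehlerRationalDatum_pull_levelCover_eq_pull_heckeTranslate`
(Fubini–Study class of the Poincaré-series embedding); the remaining hypothesis (R3) is the classical normality of Hecke
operators (`ᵗT_γ = T_{γ⁻¹}`, commutativity of the Hecke ring). [cite: Shimura1971, §3.1 Prop. 3.1, §3.4 (3.4.5), §7.2–7.3]
[cite: VoisinHodgeI2002, §7.1.2] [cite: Lange2023AbelianVarietiesC, §2.4.1 Thm. 2.4.9] -/
theorem exists_heckeOperator_isSemisimple_heckePair_of_commute (hHD : exists_isReal_hodgeModel)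
    (hI : hodgePQ_independent_of_hodgeModel) (Γ : Level V) (h : (pmsCode L ι₁ V Γ).IsAnisotropic)
    {γ : GL (Fin 3) L} (hγ : γ ∈ unitaryGroup (cmConjRingHom L) V.Hm) :
    ∃ (f₁ g : Var.scheme hU h₃ (.pms (pmsCode L ι₁ V (Γ.heckePair γ hγ))) ⟶
        Var.scheme hU h₃ (.pms (pmsCode L ι₁ V Γ)))
      (c₁ : IsFiniteCover (AlgPoints.mapContinuous (L := ℂ) f₁))
      (c₂ : IsFiniteCover (AlgPoints.mapContinuous (L := ℂ) g)),
      (∀ v ∈ (Var.ballDatum hU h₃ (pmsCode L ι₁ V (Γ.heckePair γ hγ))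
          ((isAnisotropic_pmsCode_iff_of_level Γ (Γ.heckePair γ hγ)).2 h)).cone,
        AlgPoints.map f₁ ((Var.ballDatum hU h₃ (pmsCode L ι₁ V (Γ.heckePair γ hγ))
          ((isAnisotropic_pmsCode_iff_of_level Γ (Γ.heckePair γ hγ)).2 h)).unif v) =
          (Var.ballDatum hU h₃ (pmsCode L ι₁ V Γ) h).unif v) ∧
      (∀ v ∈ (Var.ballDatum hU h₃ (pmsCode L ι₁ V (Γ.heckePair γ hγ))
          ((isAnisotropic_pmsCode_iff_of_level Γ (Γ.heckePair γ hγ)).2 h)).cone,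
        AlgPoints.map g ((Var.ballDatum hU h₃ (pmsCode L ι₁ V (Γ.heckePair γ hγ))
          ((isAnisotropic_pmsCode_iff_of_level Γ (Γ.heckePair γ hγ)).2 h)).unif v) =
          (Var.ballDatum hU h₃ (pmsCode L ι₁ V Γ) h).unif (((γ : Matrix (Fin 3) (Fin 3) L).map ι₁) *ᵥ v)) ∧
      (c₁.transferMap (R := ℚ) 1).hom ∘ₗ BettiUniverse.pull g 1 ∈
        (BettiUniverse.hodge hHD (Var.isSmoothProjective hU h₃ (.pms (pmsCode L ι₁ V Γ))) 1).endAlg ∧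
      (Commute ((c₁.transferMap (R := ℚ) 1).hom ∘ₗ BettiUniverse.pull g 1)
          ((c₂.transferMap (R := ℚ) 1).hom ∘ₗ BettiUniverse.pull f₁ 1) →
        Module.End.IsSemisimple ((c₁.transferMap (R := ℚ) 1).hom ∘ₗ BettiUniverse.pull g 1)) := by
  obtain ⟨f₁, g, c₁, c₂, hf₁, hg, hT, hss⟩ :=
    exists_heckeOperator_isSemisimple_heckePair (hU := hU) (h₃ := h₃) hHD hI Γ h hγ
  obtain ⟨D, hD⟩ := exists_kaehlerRationalDatum_pull_levelCover_eq_pull_heckeTranslate (hU := hU) (h₃ := h₃) Γ h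
  exact ⟨f₁, g, c₁, c₂, hf₁, hg, hT, fun hc =>
    hss D (hD _ _ f₁ g γ hγ (Level.heckePair_Γ_le Γ hγ) (Level.map_conj_heckePair_Γ_le Γ hγ) hf₁ hg) hc⟩

end Normal

end Summit.HodgeConjecture.CorCM.Model

end
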